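import Literature.NumberTheory.EllipticCurves.Heights
import HarnessLib

/-!
# Discharges of the named facts in `Heights.lean` (naive and Néron–Tate heights on `E(K)`)

D-0014 keeps `Literature/` sorry-free by stating cited results as named facts `def X : Prop`.
This sibling file proves **every** named fact of `Literature.NumberTheory.EllipticCurves.Heights`
as `theorem X_holds : X` (users holding `(h : X)` are fed `X_holds`): the approximate
parallelogram law, Tate's limit, `ĥ = h + O(1)`, `ĥ ≥ 0`, `ĥ(nP) = n² ĥ(P)` (`n : ℕ`, `n : ℤ`), the
parallelogram law, additivity of the Néron–Tate pairing (`heightPairing_add_left_holds`, the fact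
this file was written for), `⟨P, P⟩ = ĥ P`, `ĥ P = 0 ↔ P` torsion, and Northcott on `E(K)` for `h`
and `ĥ`. The proofs follow Silverman, *The Arithmetic of Elliptic Curves*, 2nd ed. (GTM 106,
2009), read at the cited pages:

* **VIII.6.2** (approximate parallelogram law, pp. 205–206), for `f = x`: with
  `σ(P, Q) = (x(P)x(Q) : x(P) + x(Q) : 1) ∈ ℙ²` (Mathlib's
  `WeierstrassCurve.Affine.Point.sym2x`) and the degree-`2` morphism `g : ℙ² → ℙ²` (Mathlib's
  `WeierstrassCurve.addSubMap`, whose height bound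
  `abs_logHeight_addSubMap_sub_two_mul_logHeight_le` is Silverman's VIII.5.6 for `g`), we supply
  the two remaining ingredients: the commutative square `g(σ(P, Q)) ∼ σ(P + Q, P - Q)`
  (`exists_eval_addSubMap_sym2x`, from the addition and duplication formulas III.2.3) and
  `h(σ(R₁, R₂)) = h(R₁) + h(R₂) + O(1)` (`abs_logHeight_sym2x_sub_le`, VIII.5.9 with `d = 2`,
  from Mathlib's `Height.abs_logHeight_sym2_sub_le`). This gives
  `abs_naiveHeight_add_add_naiveHeight_sub_sub_le` over any admissibly valued field.
* **VIII.9.1** (Tate, p. 214): `|h(2Q) - 4h(Q)| ≤ C` and the telescoping sum make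
  `4⁻ᴺ h(2ᴺ P)` Cauchy (`tendsto_canonicalHeight_of`), with `|ĥ - h| ≤ C/3`
  (`exists_abs_canonicalHeight_sub_naiveHeight_le_of`, VIII.9.3(e)).
* **VIII.9.3** (Néron–Tate, p. 215): (a) by passing to the limit in VIII.6.2
  (`parallelogram_law_of`); (b) from (a) by induction (`canonicalHeight_nsmul_of`); (c) the
  alternating sum of four instances of (a) (`heightPairing_add_left_of`); (d) `ĥ ≥ 0` as a limit
  of nonnegative reals, torsion `⇒ ĥ = 0` since `2ᴺ P` takes finitely many values, and the
  converse from (b), (e) and Northcott VIII.6.1 (`canonicalHeight_eq_zero_iff_of`), where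
  Northcott on `E(K)` (`finite_setOf_naiveHeight_le_holds`) is Mathlib's
  `NumberField.finite_setOf_logHeight₁_le` plus finiteness of the fibres of `x`.

All statements are in namespace `WeierstrassCurve.Affine.Point` (deliberate dot-notation extension
of Mathlib, as in `Heights.lean`); `noncomputable section`, `open scoped Classical` as there.

## References

* J. H. Silverman, *The Arithmetic of Elliptic Curves*, 2nd ed., GTM 106, Springer 2009:
  III.2.3 (group law formulas), VIII.5.6, VIII.5.9, VIII.5.11 (heights on `ℙⁿ`), Prop. VIII.6.1,
  Thm. VIII.6.2, Cor. VIII.6.4, Prop. VIII.9.1, Thm. VIII.9.3. [cite: SilvermanAEC2009]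
-/

noncomputable section

open scoped Classical

open Filter Topology

namespace WeierstrassCurve.Affine.Point

section AddSub

variable {K : Type*} [Field K] {W : WeierstrassCurve K}

open MvPolynomial

/-- Explicit evaluation of the three quadrics of `addSubMap` (Silverman's `g : ℙ² → ℙ²`,
AEC proof of Thm. VIII.6.2, in general Weierstrass form). [cite: SilvermanAEC2009, proof of
Thm. VIII.6.2] -/
theorem eval_addSubMap (v : Fin 3 → K) :
    (fun i => (addSubMap W i).eval v) =
      ![v 0 ^ 2 - W.b₄ * v 0 * v 2 - W.b₆ * v 1 * v 2 - W.b₈ * v 2 ^ 2,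
        2 * v 1 * v 0 + W.b₂ * v 0 * v 2 + W.b₄ * v 1 * v 2 + W.b₆ * v 2 ^ 2,
        v 1 ^ 2 - 4 * v 0 * v 2] := by
  funext i
  fin_cases i <;> simp [addSubMap]

/-- `x(P + Q)` for `x(P) ≠ x(Q)` as a single fraction with denominator `(x₁ - x₂)²`
(Silverman, AEC III.2.3). [cite: SilvermanAEC2009, III.2.3] -/
theorem addX_slope_eq_div {x₁ x₂ : K} (y₁ y₂ : K) (hx : x₁ ≠ x₂) :
    W.toAffine.addX x₁ x₂ (W.toAffine.slope x₁ x₂ y₁ y₂) =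
      ((y₁ - y₂) ^ 2 + W.a₁ * (y₁ - y₂) * (x₁ - x₂) -
        (W.a₂ + x₁ + x₂) * (x₁ - x₂) ^ 2) / (x₁ - x₂) ^ 2 := by
  have hd : x₁ - x₂ ≠ 0 := sub_ne_zero.mpr hx
  rw [slope_of_X_ne hx, addX]
  field_simp
  ring

/-- `x(2P)` for `P` not `2`-torsion as a single fraction with denominator `ψ₂(P)²`
(Silverman, AEC III.2.3(d), duplication formula). [cite: SilvermanAEC2009, III.2.3(d)] -/
theorem addX_slope_self_eq_div {x₁ y₁ : K} (hy : y₁ ≠ W.toAffine.negY x₁ y₁) :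
    W.toAffine.addX x₁ x₁ (W.toAffine.slope x₁ x₁ y₁ y₁) =
      ((3 * x₁ ^ 2 + 2 * W.a₂ * x₁ + W.a₄ - W.a₁ * y₁) ^ 2 +
        W.a₁ * (3 * x₁ ^ 2 + 2 * W.a₂ * x₁ + W.a₄ - W.a₁ * y₁) *
          (y₁ - W.toAffine.negY x₁ y₁) -
        (W.a₂ + 2 * x₁) * (y₁ - W.toAffine.negY x₁ y₁) ^ 2) /
        (y₁ - W.toAffine.negY x₁ y₁) ^ 2 := by
  have hd : y₁ - W.toAffine.negY x₁ y₁ ≠ 0 := sub_ne_zero.mpr hy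
  rw [slope_of_Y_ne rfl hy, addX]
  field_simp
  ring

/-- Polynomial identity behind `x(P+Q) + x(P-Q)` (Silverman, AEC, proof of Thm. VIII.6.2:
`x₃ + x₄ = (2(x₁ + x₂)(A + x₁x₂) + 4B) / (x₁ - x₂)²` in short form).
[cite: SilvermanAEC2009, proof of Thm. VIII.6.2] -/
theorem numer_add_add_numer_sub {x₁ x₂ y₁ y₂ : K} (h₁ : W.toAffine.Equation x₁ y₁)
    (h₂ : W.toAffine.Equation x₂ y₂) :
    ((y₁ - y₂) ^ 2 + W.a₁ * (y₁ - y₂) * (x₁ - x₂) - (W.a₂ + x₁ + x₂) * (x₁ - x₂) ^ 2) +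
      ((y₁ - W.toAffine.negY x₂ y₂) ^ 2 +
        W.a₁ * (y₁ - W.toAffine.negY x₂ y₂) * (x₁ - x₂) - (W.a₂ + x₁ + x₂) * (x₁ - x₂) ^ 2) =
      2 * (x₁ + x₂) * (x₁ * x₂) + W.b₂ * (x₁ * x₂) * 1 + W.b₄ * (x₁ + x₂) * 1 +
        W.b₆ * 1 ^ 2 := by
  rw [equation_iff] at h₁ h₂
  simp only [negY, b₂, b₄, b₆]
  linear_combination 2 * h₁ + 2 * h₂

/-- Polynomial identity behind `x(P+Q) · x(P-Q)` (Silverman, AEC, proof of Thm. VIII.6.2: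
`x₃x₄ = ((x₁x₂ - A)² - 4B(x₁ + x₂)) / (x₁ - x₂)²` in short form); the two cofactors were
found with a computer algebra system. [cite: SilvermanAEC2009, proof of Thm. VIII.6.2] -/
theorem numer_add_mul_numer_sub {x₁ x₂ y₁ y₂ : K} (h₁ : W.toAffine.Equation x₁ y₁)
    (h₂ : W.toAffine.Equation x₂ y₂) :
    ((y₁ - y₂) ^ 2 + W.a₁ * (y₁ - y₂) * (x₁ - x₂) - (W.a₂ + x₁ + x₂) * (x₁ - x₂) ^ 2) *
      ((y₁ - W.toAffine.negY x₂ y₂) ^ 2 +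
        W.a₁ * (y₁ - W.toAffine.negY x₂ y₂) * (x₁ - x₂) - (W.a₂ + x₁ + x₂) * (x₁ - x₂) ^ 2) =
      (x₁ - x₂) ^ 2 *
        ((x₁ * x₂) ^ 2 - W.b₄ * (x₁ * x₂) * 1 - W.b₆ * (x₁ + x₂) * 1 - W.b₈ * 1 ^ 2) := by
  rw [equation_iff] at h₁ h₂
  simp only [negY, b₄, b₆, b₈]
  linear_combination
    (W.a₁ ^ 2 * x₁ * x₂ - W.a₁ ^ 2 * x₂ ^ 2 + W.a₁ * W.a₃ * x₁ - W.a₂ * x₁ ^ 2 - x₁ ^ 3 +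
      W.a₁ * x₁ * y₁ - W.a₁ * W.a₃ * x₂ + 4 * W.a₂ * x₁ * x₂ + 2 * x₁ ^ 2 * x₂ +
      2 * x₁ * x₂ ^ 2 - 4 * W.a₁ * x₂ * y₂ + W.a₄ * x₁ + W.a₃ * y₁ + y₁ ^ 2 + 2 * W.a₄ * x₂ -
      4 * W.a₃ * y₂ - 4 * y₂ ^ 2 + 3 * W.a₆) * h₁ +
    (-W.a₁ ^ 2 * x₁ ^ 2 + W.a₁ ^ 2 * x₁ * x₂ - W.a₁ * W.a₃ * x₁ - 6 * W.a₂ * x₁ ^ 2 -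
      6 * x₁ ^ 3 + 2 * W.a₁ * x₁ * y₁ + W.a₁ * W.a₃ * x₂ + 4 * W.a₂ * x₁ * x₂ +
      2 * x₁ ^ 2 * x₂ - W.a₂ * x₂ ^ 2 + 2 * x₁ * x₂ ^ 2 - x₂ ^ 3 + W.a₁ * x₂ * y₂ -
      4 * W.a₄ * x₁ + 2 * W.a₃ * y₁ + 2 * y₁ ^ 2 + W.a₄ * x₂ + W.a₃ * y₂ + y₂ ^ 2 -
      3 * W.a₆) * h₂

/-- `ψ₂(P)² = (2y + a₁x + a₃)² = 4x³ + b₂x² + 2b₄x + b₆` on the curve (Silverman, AEC III.2.3(d),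
written in the shape of the second quadric of `addSubMap` at `σ(P, P)`).
[cite: SilvermanAEC2009, III.2.3(d)] -/
theorem psi_sq_eq {x₁ y₁ : K} (h₁ : W.toAffine.Equation x₁ y₁) :
    (y₁ - W.toAffine.negY x₁ y₁) ^ 2 =
      2 * (x₁ + x₁) * (x₁ * x₁) + W.b₂ * (x₁ * x₁) * 1 + W.b₄ * (x₁ + x₁) * 1 +
        W.b₆ * 1 ^ 2 := by
  rw [equation_iff] at h₁
  simp only [negY, b₂, b₄, b₆]
  linear_combination 4 * h₁

/-- Polynomial identity behind the duplication formula
`x(2P) = (x⁴ - b₄x² - 2b₆x - b₈) / (4x³ + b₂x² + 2b₄x + b₆)` (Silverman, AEC III.2.3(d)).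
[cite: SilvermanAEC2009, III.2.3(d)] -/
theorem numer_two_mul_eq {x₁ y₁ : K} (h₁ : W.toAffine.Equation x₁ y₁) :
    (3 * x₁ ^ 2 + 2 * W.a₂ * x₁ + W.a₄ - W.a₁ * y₁) ^ 2 +
        W.a₁ * (3 * x₁ ^ 2 + 2 * W.a₂ * x₁ + W.a₄ - W.a₁ * y₁) *
          (y₁ - W.toAffine.negY x₁ y₁) -
        (W.a₂ + 2 * x₁) * (y₁ - W.toAffine.negY x₁ y₁) ^ 2 =
      (x₁ * x₁) ^ 2 - W.b₄ * (x₁ * x₁) * 1 - W.b₆ * (x₁ + x₁) * 1 - W.b₈ * 1 ^ 2 := by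
  rw [equation_iff] at h₁
  simp only [negY, b₄, b₆, b₈]
  linear_combination (-W.a₁ ^ 2 - 4 * W.a₂ - 8 * x₁) * h₁

/-- `eval_addSubMap` on a literal vector `(s : t : u)`. [cite: SilvermanAEC2009, proof of
Thm. VIII.6.2] -/
theorem eval_addSubMap_vec (s t u : K) :
    (fun i => (addSubMap W i).eval ![s, t, u]) =
      ![s ^ 2 - W.b₄ * s * u - W.b₆ * t * u - W.b₈ * u ^ 2,
        2 * t * s + W.b₂ * s * u + W.b₄ * t * u + W.b₆ * u ^ 2, t ^ 2 - 4 * s * u] := by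
  rw [eval_addSubMap]
  simp

/-- Doubling case of `exists_eval_addSubMap_sym2x`: `g(σ(P, P)) ∼ σ(2P, O)` (Silverman, AEC,
proof of Thm. VIII.6.2, case `P = ±Q`). [cite: SilvermanAEC2009, proof of Thm. VIII.6.2] -/
theorem exists_eval_addSubMap_sym2x_self (P : W.toAffine.Point) :
    ∃ c : K, (fun i => (addSubMap W i).eval (sym2x P P)) = c • sym2x (P + P) 0 := by
  rcases P with _ | ⟨x₁, y₁, h₁⟩
  · refine ⟨1, ?_⟩
    rw [← zero_def, add_zero, sym2x_zero_zero, eval_addSubMap_vec, one_smul]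
    simp
  · by_cases hy : y₁ = W.toAffine.negY x₁ y₁
    · -- `P` is `2`-torsion: `2P = O`
      refine ⟨(x₁ * x₁) ^ 2 - W.b₄ * (x₁ * x₁) * 1 - W.b₆ * (x₁ + x₁) * 1 - W.b₈ * 1 ^ 2,
        ?_⟩
      rw [add_self_of_Y_eq hy, sym2x_some_some, eval_addSubMap_vec, sym2x_zero_zero,
        Matrix.smul_vec3]
      have hψ : (y₁ - W.toAffine.negY x₁ y₁) = 0 := by rw [← hy, sub_self]
      have h2 := psi_sq_eq h₁.left
      rw [hψ] at h2
      refine Matrix.vec3_eq ?_ ?_ ?_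
      · rw [smul_eq_mul]
        ring
      · rw [smul_zero, ← h2]
        ring
      · rw [smul_zero]
        ring
    · refine ⟨(y₁ - W.toAffine.negY x₁ y₁) ^ 2, ?_⟩
      rw [add_self_of_Y_ne hy, sym2x_some_some, eval_addSubMap_vec, sym2x_some_zero,
        addX_slope_self_eq_div hy, Matrix.smul_vec3]
      have hψ : (y₁ - W.toAffine.negY x₁ y₁) ≠ 0 := sub_ne_zero.mpr hy
      refine Matrix.vec3_eq ?_ ?_ ?_
      · rw [smul_eq_mul, mul_div_cancel₀ _ (pow_ne_zero 2 hψ), numer_two_mul_eq h₁.left]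
      · rw [smul_eq_mul, psi_sq_eq h₁.left]
        ring
      · rw [smul_zero]
        ring

/-- Generic case of `exists_eval_addSubMap_sym2x`: two affine points with distinct
`x`-coordinates; the scalar is `(x₁ - x₂)²` (Silverman, AEC, proof of Thm. VIII.6.2).
[cite: SilvermanAEC2009, proof of Thm. VIII.6.2] -/
theorem eval_addSubMap_sym2x_of_X_ne {x₁ x₂ y₁ y₂ : K}
    (h₁ : W.toAffine.Nonsingular x₁ y₁) (h₂ : W.toAffine.Nonsingular x₂ y₂) (hx : x₁ ≠ x₂) :
    (fun i => (addSubMap W i).eval (sym2x (some x₁ y₁ h₁) (some x₂ y₂ h₂))) =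
      (x₁ - x₂) ^ 2 •
        sym2x (some x₁ y₁ h₁ + some x₂ y₂ h₂) (some x₁ y₁ h₁ - some x₂ y₂ h₂) := by
  rw [sub_eq_add_neg (some x₁ y₁ h₁), neg_some, add_of_X_ne hx, add_of_X_ne hx,
    sym2x_some_some, sym2x_some_some, eval_addSubMap_vec, addX_slope_eq_div _ _ hx,
    addX_slope_eq_div _ _ hx, Matrix.smul_vec3]
  have hd : (x₁ - x₂) ^ 2 ≠ 0 := pow_ne_zero 2 (sub_ne_zero.mpr hx)
  refine Matrix.vec3_eq ?_ ?_ ?_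
  · rw [smul_eq_mul, div_mul_div_comm, ← mul_div_assoc,
      numer_add_mul_numer_sub h₁.left h₂.left]
    field_simp
  · rw [smul_eq_mul, ← add_div, mul_div_cancel₀ _ hd,
      numer_add_add_numer_sub h₁.left h₂.left]
  · rw [smul_eq_mul, mul_one]
    ring

/-- **Compatibility of `addSubMap` with the group law** (Silverman, AEC, proof of Thm. VIII.6.2:
the commutative square `g ∘ σ = σ ∘ G` with `G(P, Q) = (P + Q, P - Q)`): the quadrics
`addSubMap W` send (a representative of) `σ(P, Q) = (x(P)x(Q) : x(P) + x(Q) : 1)` to a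
multiple of `σ(P + Q, P - Q)`. This is the "TODO: Show that the map really does what it is
claimed to do" of `Mathlib/AlgebraicGeometry/EllipticCurve/Affine/AddSubMap.lean`.
[cite: SilvermanAEC2009, proof of Thm. VIII.6.2] -/
theorem exists_eval_addSubMap_sym2x (P Q : W.toAffine.Point) :
    ∃ c : K, (fun i => (addSubMap W i).eval (sym2x P Q)) = c • sym2x (P + Q) (P - Q) := by
  rcases P with _ | ⟨x₁, y₁, h₁⟩ <;> rcases Q with _ | ⟨x₂, y₂, h₂⟩
  · rw [← zero_def, sub_zero]
    exact exists_eval_addSubMap_sym2x_self 0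
  · refine ⟨1, ?_⟩
    rw [← zero_def, zero_add, zero_sub, sym2x_neg_right, sym2x_zero_some, eval_addSubMap_vec,
      sym2x_some_some, one_smul]
    refine Matrix.vec3_eq ?_ ?_ ?_ <;> ring
  · refine ⟨1, ?_⟩
    rw [← zero_def, add_zero, sub_zero, sym2x_some_zero, eval_addSubMap_vec, sym2x_some_some,
      one_smul]
    refine Matrix.vec3_eq ?_ ?_ ?_ <;> ring
  · by_cases hx : x₁ = x₂
    · rcases (X_eq_iff (h₁ := h₁) (h₂ := h₂)).mp hx with h | h
      · rw [← h, sub_self]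
        exact exists_eval_addSubMap_sym2x_self _
      · rw [← neg_eq_iff_eq_neg] at h
        rw [← h, sym2x_neg_right, add_neg_cancel, sub_neg_eq_add, sym2x_comm 0]
        exact exists_eval_addSubMap_sym2x_self _
    · exact ⟨_, eval_addSubMap_sym2x_of_X_ne h₁ h₂ hx⟩

/-- Nonvanishing version of `exists_eval_addSubMap_sym2x` on an elliptic curve: the scalar is
nonzero because `addSubMap` has no base points (`addSubMap_ne_zero`, which uses `Δ ≠ 0`;
Silverman: "`g` is a morphism"). [cite: SilvermanAEC2009, proof of Thm. VIII.6.2] -/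
theorem exists_ne_zero_eval_addSubMap_sym2x [W.IsElliptic] (P Q : W.toAffine.Point) :
    ∃ c : K, c ≠ 0 ∧
      (fun i => (addSubMap W i).eval (sym2x P Q)) = c • sym2x (P + Q) (P - Q) := by
  obtain ⟨c, hc⟩ := exists_eval_addSubMap_sym2x P Q
  refine ⟨c, fun h0 => ?_, hc⟩
  rw [h0, zero_smul] at hc
  exact addSubMap_ne_zero W (sym2x_ne_zero P Q) hc

end AddSub

section Fibre

variable {K : Type*} [Field K] {W : WeierstrassCurve K}

/-- The fibre of `x : E(K) → ℙ¹(K)` over an affine value `x` is finite (the `y` are roots of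
the monic quadratic `W(x, Y)`). Used for Northcott on `E(K)`, Silverman AEC Prop. VIII.6.1.
[cite: SilvermanAEC2009, Prop. VIII.6.1] -/
theorem finite_setOf_eq_some (x : K) :
    {P : W.toAffine.Point | ∃ y h, P = some x y h}.Finite := by
  have hq : (W.toAffine.polynomial.map (Polynomial.evalRingHom x)) ≠ 0 :=
    (monic_polynomial.map _).ne_zero
  refine ((Polynomial.finite_setOf_isRoot hq).image fun y : K =>
    if h : W.toAffine.Nonsingular x y then (some x y h : W.toAffine.Point) else 0).subset ?_
  rintro P ⟨y, h, rfl⟩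
  refine ⟨y, ?_, by simp [h]⟩
  simp only [Set.mem_setOf_eq, Polynomial.IsRoot.def, Polynomial.map_evalRingHom_eval]
  exact h.left

end Fibre

section ApproximateParallelogramLaw

variable {K : Type*} [Field K] [Height.AdmissibleAbsValues K] {W : WeierstrassCurve K}

open Height

/-- The naive height is the logarithmic height of the representative `xRep P` of
`x(P) ∈ ℙ¹(K)` (definition of `h_x`, Silverman AEC VIII.6). [cite: SilvermanAEC2009, VIII.6] -/
theorem logHeight_xRep (P : W.toAffine.Point) : logHeight P.xRep = naiveHeight P := by
  rcases P with _ | ⟨x, y, h⟩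
  · rw [← zero_def, xRep_zero, naiveHeight_zero, logHeight_swap, ← logHeight₁_eq_logHeight,
      logHeight₁_zero]
  · rw [xRep_some, naiveHeight_some, logHeight₁_eq_logHeight]

/-- `h(σ(P, Q)) = h_x(P) + h_x(Q) + O(1)` (Silverman, AEC, proof of Thm. VIII.6.2, via
VIII.5.9 with `d = 2`; here from Mathlib's `Height.abs_logHeight_sym2_sub_le`).
[cite: SilvermanAEC2009, proof of Thm. VIII.6.2 and Thm. VIII.5.9] -/
theorem abs_logHeight_sym2x_sub_le :
    ∃ C : ℝ, ∀ P Q : W.toAffine.Point,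
      |logHeight (sym2x P Q) - (naiveHeight P + naiveHeight Q)| ≤ C := by
  obtain ⟨C, hC⟩ := Height.abs_logHeight_sym2_sub_le K
  refine ⟨C, fun P Q => ?_⟩
  have hP : ![P.xRep 0, P.xRep 1] = P.xRep := by ext i; fin_cases i <;> rfl
  have hQ : ![Q.xRep 0, Q.xRep 1] = Q.xRep := by ext i; fin_cases i <;> rfl
  have h := hC (a := P.xRep 0) (b := P.xRep 1) (c := Q.xRep 0) (d := Q.xRep 1)
    (hP ▸ xRep_ne_zero P) (hQ ▸ xRep_ne_zero Q)
  rwa [hP, hQ, logHeight_xRep, logHeight_xRep] at h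

/-- **Approximate parallelogram law** for the naive height over any admissibly valued field:
`|h(P + Q) + h(P - Q) - 2 h(P) - 2 h(Q)| ≤ C(W)`. Silverman, AEC Theorem VIII.6.2 (for `f = x`),
whose proof this follows: `h(σ(P+Q, P-Q)) = h(g(σ(P, Q))) = 2 h(σ(P, Q)) + O(1)` since `g` is a
morphism of degree `2` (Mathlib's `abs_logHeight_addSubMap_sub_two_mul_logHeight_le` and
`exists_ne_zero_eval_addSubMap_sym2x`), and `h(σ(R₁, R₂)) = h(R₁) + h(R₂) + O(1)`
(`abs_logHeight_sym2x_sub_le`). [cite: SilvermanAEC2009, Thm. VIII.6.2] -/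
theorem abs_naiveHeight_add_add_naiveHeight_sub_sub_le [W.IsElliptic] :
    ∃ C : ℝ, ∀ P Q : W.toAffine.Point,
      |naiveHeight (P + Q) + naiveHeight (P - Q) - 2 * naiveHeight P - 2 * naiveHeight Q| ≤
        C := by
  obtain ⟨C₁, hC₁⟩ := abs_logHeight_addSubMap_sub_two_mul_logHeight_le W
  obtain ⟨C₂, hC₂⟩ := abs_logHeight_sym2x_sub_le (W := W)
  refine ⟨C₁ + 3 * C₂, fun P Q => ?_⟩
  obtain ⟨c, hc, h⟩ := exists_ne_zero_eval_addSubMap_sym2x P Q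
  have h₁ := hC₁ (sym2x P Q)
  rw [h, logHeight_smul_eq_logHeight _ hc] at h₁
  have h₂ := hC₂ (P + Q) (P - Q)
  have h₃ := hC₂ P Q
  rw [abs_le] at h₁ h₂ h₃ ⊢
  constructor <;> linarith [h₁.1, h₁.2, h₂.1, h₂.2, h₃.1, h₃.2]

end ApproximateParallelogramLaw

section NumberFieldProofs

variable {K : Type*} [Field K] [NumberField K] {W : WeierstrassCurve K}

/-- **VIII.9.3(c) from (a)**: additivity of the pairing from the parallelogram law, by the
alternating sum of the four instances `(P+R, Q)`, `(P, R-Q)`, `(P+Q, R)`, `(R, Q)` of (a)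
(Silverman's "standard fact from linear algebra", proof of Thm. VIII.9.3(c), p. 215).
[cite: SilvermanAEC2009, Thm. VIII.9.3(c)] -/
theorem heightPairing_add_left_of (h : parallelogram_law (W := W)) :
    heightPairing_add_left (W := W) := by
  intro _ P Q R
  have h1 := h (P + R) Q
  have h2 := h P (R - Q)
  have h3 := h (P + Q) R
  have h4 := h R Q
  rw [show P + R + Q = P + Q + R by abel] at h1
  rw [show P + (R - Q) = P + R - Q by abel, show P - (R - Q) = P + Q - R by abel] at h2
  rw [add_comm R Q] at h4
  simp only [heightPairing]
  linarith

/-- Corollary VIII.6.4(b) with `m = 2` (`|h(2P) - 4h(P)| ≤ C`) from Theorem VIII.6.2 with `Q = P`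
and `h(O) = 0`. [cite: SilvermanAEC2009, Cor. VIII.6.4(b)] -/
theorem exists_abs_naiveHeight_two_nsmul_sub_le_of
    (h : exists_abs_naiveHeight_add_add_naiveHeight_sub_sub_le (W := W)) :
    exists_abs_naiveHeight_two_nsmul_sub_le (W := W) := by
  intro _
  obtain ⟨C, hC⟩ := h
  refine ⟨C, fun P => ?_⟩
  have := hC P P
  simp only [sub_self, naiveHeight_zero, add_zero] at this
  rw [two_smul]
  convert this using 2
  ring

/-- The step estimate `|4^{-(n+1)} h(2^{n+1} P) - 4^{-n} h(2^n P)| ≤ (C/4) (1/4)^n` of the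
telescoping sum in the proof of Proposition VIII.9.1. [cite: SilvermanAEC2009, Prop. VIII.9.1] -/
theorem dist_naiveHeight_succ_le {C : ℝ}
    (hC : ∀ P : W.toAffine.Point, |naiveHeight (2 • P) - 4 * naiveHeight P| ≤ C)
    (P : W.toAffine.Point) (n : ℕ) :
    dist (naiveHeight ((2 ^ n) • P) / 4 ^ n) (naiveHeight ((2 ^ (n + 1)) • P) / 4 ^ (n + 1)) ≤
      C / 4 * (1 / 4) ^ n := by
  rw [Real.dist_eq, abs_sub_comm, pow_succ' 2 n, mul_smul]
  have h := hC ((2 ^ n) • P)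
  have h4 : (0 : ℝ) < 4 ^ (n + 1) := by positivity
  rw [show naiveHeight (2 • (2 ^ n) • P) / 4 ^ (n + 1) - naiveHeight ((2 ^ n) • P) / 4 ^ n =
      (naiveHeight (2 • (2 ^ n) • P) - 4 * naiveHeight ((2 ^ n) • P)) / 4 ^ (n + 1) by
      rw [pow_succ]; field_simp]
  rw [abs_div, abs_of_pos h4, div_le_iff₀ h4]
  calc |naiveHeight (2 • (2 ^ n) • P) - 4 * naiveHeight ((2 ^ n) • P)| ≤ C := h
    _ = C / 4 * (1 / 4) ^ n * 4 ^ (n + 1) := by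
        have h4n : (4 : ℝ) ^ n ≠ 0 := by positivity
        rw [pow_succ, one_div_pow]
        field_simp

/-- **Proposition VIII.9.1** (Tate): `4^{-N} h(2^N P)` is Cauchy, hence converges (to
`canonicalHeight P`, a `limUnder`), from `|h(2Q) - 4h(Q)| ≤ C`.
[cite: SilvermanAEC2009, Prop. VIII.9.1] -/
theorem tendsto_canonicalHeight_of (h : exists_abs_naiveHeight_two_nsmul_sub_le (W := W)) :
    tendsto_canonicalHeight (W := W) := by
  intro _ P
  obtain ⟨C, hC⟩ := h
  have hcs : CauchySeq (fun n : ℕ => naiveHeight ((2 ^ n) • P) / 4 ^ n) :=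
    cauchySeq_of_le_geometric (1 / 4) (C / 4) (by norm_num) (dist_naiveHeight_succ_le hC P)
  exact tendsto_nhds_limUnder (cauchySeq_tendsto_of_complete hcs)

/-- **Theorem VIII.9.3(a)** (parallelogram law) from VIII.6.2 and VIII.9.1: replace `P, Q` by
`2^N P, 2^N Q`, divide by `4^N` and let `N → ∞`. [cite: SilvermanAEC2009, Thm. VIII.9.3(a)] -/
theorem parallelogram_law_of
    (h₁ : exists_abs_naiveHeight_add_add_naiveHeight_sub_sub_le (W := W))
    (h₂ : tendsto_canonicalHeight (W := W)) : parallelogram_law (W := W) := by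
  intro _ P Q
  obtain ⟨C, hC⟩ := h₁
  set f : W.toAffine.Point → ℕ → ℝ := fun R n => naiveHeight ((2 ^ n) • R) / 4 ^ n with hf
  have hlim : Tendsto (fun n => f (P + Q) n + f (P - Q) n - 2 * f P n - 2 * f Q n) atTop
      (𝓝 (canonicalHeight (P + Q) + canonicalHeight (P - Q) -
        2 * canonicalHeight P - 2 * canonicalHeight Q)) :=
    (((h₂ (P + Q)).add (h₂ (P - Q))).sub ((h₂ P).const_mul 2)).sub ((h₂ Q).const_mul 2)
  have hzero : Tendsto (fun n => f (P + Q) n + f (P - Q) n - 2 * f P n - 2 * f Q n) atTop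
      (𝓝 0) := by
    have hg : Tendsto (fun n : ℕ => C / 4 ^ n) atTop (𝓝 0) := by
      simpa [div_eq_mul_inv, ← inv_pow] using
        (tendsto_pow_atTop_nhds_zero_of_lt_one (by norm_num : (0 : ℝ) ≤ 4⁻¹)
          (by norm_num)).const_mul C
    refine squeeze_zero_norm (fun n => ?_) hg
    have h4 : (0 : ℝ) < 4 ^ n := by positivity
    simp only [hf, Real.norm_eq_abs, smul_add, smul_sub]
    rw [show naiveHeight ((2 ^ n) • P + (2 ^ n) • Q) / 4 ^ n +
        naiveHeight ((2 ^ n) • P - (2 ^ n) • Q) / 4 ^ n -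
        2 * (naiveHeight ((2 ^ n) • P) / 4 ^ n) - 2 * (naiveHeight ((2 ^ n) • Q) / 4 ^ n) =
        (naiveHeight ((2 ^ n) • P + (2 ^ n) • Q) + naiveHeight ((2 ^ n) • P - (2 ^ n) • Q) -
        2 * naiveHeight ((2 ^ n) • P) - 2 * naiveHeight ((2 ^ n) • Q)) / 4 ^ n by
        field_simp, abs_div, abs_of_pos h4]
    exact div_le_div_of_nonneg_right (hC _ _) h4.le
  have := tendsto_nhds_unique hlim hzero
  linarith

/-- **Theorem VIII.9.3(e)** for `f = x`: `|ĥ - h| ≤ C/3` (take `M = 0`, `N → ∞` in the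
telescoping estimate). [cite: SilvermanAEC2009, Thm. VIII.9.3(e)] -/
theorem exists_abs_canonicalHeight_sub_naiveHeight_le_of
    (h : exists_abs_naiveHeight_two_nsmul_sub_le (W := W)) :
    exists_abs_canonicalHeight_sub_naiveHeight_le (W := W) := by
  intro _
  obtain ⟨C, hC⟩ := h
  refine ⟨C / 4 / (1 - 1 / 4), fun P => ?_⟩
  have ht := tendsto_canonicalHeight_of ⟨C, hC⟩ P
  have := dist_le_of_le_geometric_of_tendsto₀ (1 / 4) (C / 4) (by norm_num)
    (dist_naiveHeight_succ_le hC P) ht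
  rwa [Real.dist_eq, pow_zero, one_smul, pow_zero, div_one, abs_sub_comm] at this

/-- **Theorem VIII.9.3(d)**, first part: `ĥ ≥ 0` as a limit of nonnegative reals.
[cite: SilvermanAEC2009, Thm. VIII.9.3(d)] -/
theorem canonicalHeight_nonneg_of (h : tendsto_canonicalHeight (W := W)) :
    canonicalHeight_nonneg (W := W) := by
  intro _ P
  exact ge_of_tendsto' (h P) fun n => div_nonneg (naiveHeight_nonneg _) (by positivity)

/-- **Theorem VIII.9.3(b)** for `n : ℕ` from (a) by induction on `n` (the "alternative proof"
in Silverman). [cite: SilvermanAEC2009, Thm. VIII.9.3(b)] -/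
theorem canonicalHeight_nsmul_of (h : parallelogram_law (W := W)) :
    canonicalHeight_nsmul (W := W) := by
  intro _ n
  induction n using Nat.strong_induction_on with
  | _ n ih =>
    intro P
    match n with
    | 0 => simp
    | 1 => simp
    | (m + 2) =>
      have h1 := ih (m + 1) (by omega) P
      have h0 := ih m (by omega) P
      have hp := h ((m + 1) • P) P
      rw [← succ_nsmul, show (m + 1) • P - P = m • P by rw [succ_nsmul, add_sub_cancel_right]]
        at hp
      push_cast at h1 h0 ⊢
      linarith

/-- **Theorem VIII.9.3(b)** for `n : ℤ`, from the `ℕ` case and evenness of `ĥ`.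
[cite: SilvermanAEC2009, Thm. VIII.9.3(b)] -/
theorem canonicalHeight_zsmul_of (h : canonicalHeight_nsmul (W := W)) :
    canonicalHeight_zsmul (W := W) := by
  intro _ n P
  obtain ⟨m, rfl | rfl⟩ := Int.eq_nat_or_neg n
  · rw [natCast_zsmul, h]
    push_cast
    ring
  · rw [neg_smul, canonicalHeight_neg, natCast_zsmul, h]
    push_cast
    ring

/-- **Proposition VIII.6.1** (Northcott on `E(K)`) holds: `x` is finite-to-one onto a set of
bounded height in `ℙ¹(K)`, finite by Mathlib's `NumberField.finite_setOf_logHeight₁_le`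
(Northcott, VIII.5.11). [cite: SilvermanAEC2009, Prop. VIII.6.1] -/
theorem finite_setOf_naiveHeight_le_holds : finite_setOf_naiveHeight_le (W := W) := by
  intro _ B
  have hS := NumberField.finite_setOf_logHeight₁_le K B
  refine ((hS.biUnion fun x _ => finite_setOf_eq_some (W := W) x).union
    (Set.finite_singleton 0)).subset ?_
  rintro (_ | ⟨x, y, h⟩) hP
  · exact Or.inr rfl
  · refine Or.inl (Set.mem_biUnion (x := x) ?_ ⟨y, h, rfl⟩)
    simpa using hP

/-- Torsion points have canonical height `0`: `2^N P` takes finitely many values, so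
`4^{-N} h(2^N P) → 0` (Silverman, proof of Thm. VIII.9.3(d)). [cite: SilvermanAEC2009,
Thm. VIII.9.3(d)] -/
theorem canonicalHeight_of_isOfFinAddOrder_holds :
    canonicalHeight_of_isOfFinAddOrder (W := W) := by
  intro _ P hP
  have hfin : (AddSubmonoid.multiples P : Set W.toAffine.Point).Finite :=
    finite_multiples.mpr hP
  obtain ⟨B, hB⟩ := (hfin.image naiveHeight).bddAbove
  have hB' : ∀ n : ℕ, naiveHeight ((2 ^ n) • P) ≤ B := fun n =>
    hB ⟨(2 ^ n) • P, ⟨2 ^ n, rfl⟩, rfl⟩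
  have h0 : Tendsto (fun n : ℕ => naiveHeight ((2 ^ n) • P) / 4 ^ n) atTop (𝓝 0) := by
    have hg : Tendsto (fun n : ℕ => B / 4 ^ n) atTop (𝓝 0) := by
      simpa [div_eq_mul_inv, ← inv_pow] using
        (tendsto_pow_atTop_nhds_zero_of_lt_one (by norm_num : (0 : ℝ) ≤ 4⁻¹)
          (by norm_num)).const_mul B
    refine squeeze_zero (fun n => div_nonneg (naiveHeight_nonneg _) (by positivity))
      (fun n => div_le_div_of_nonneg_right (hB' n) (by positivity)) hg
  exact h0.limUnder_eq

/-- **Theorem VIII.9.3(d)**: `ĥ P = 0 ↔ P` torsion; `⇒` since then `h(mP) ≤ C` for all `m` by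
(b) and (e), so `{mP}` is finite by Northcott VIII.6.1.
[cite: SilvermanAEC2009, Thm. VIII.9.3(d)] -/
theorem canonicalHeight_eq_zero_iff_of (h₁ : canonicalHeight_nsmul (W := W))
    (h₂ : exists_abs_canonicalHeight_sub_naiveHeight_le (W := W)) :
    canonicalHeight_eq_zero_iff (W := W) := by
  intro _ P
  refine ⟨fun hP => ?_, fun hP => canonicalHeight_of_isOfFinAddOrder_holds hP⟩
  obtain ⟨C, hC⟩ := h₂
  rw [← finite_multiples]
  refine (finite_setOf_naiveHeight_le_holds (W := W) C).subset ?_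
  rintro _ ⟨n, rfl⟩
  have h := hC (n • P)
  rw [h₁ n P, hP, mul_zero, zero_sub, abs_neg, abs_of_nonneg (naiveHeight_nonneg _)] at h
  exact h

/-- **Silverman, AEC Theorem VIII.6.2** (approximate parallelogram law) holds over a number field.
[cite: SilvermanAEC2009, Thm. VIII.6.2] -/
theorem exists_abs_naiveHeight_add_add_naiveHeight_sub_sub_le_holds :
    exists_abs_naiveHeight_add_add_naiveHeight_sub_sub_le (W := W) := by
  intro _
  exact abs_naiveHeight_add_add_naiveHeight_sub_sub_le

/-- **Silverman, AEC Corollary VIII.6.4(b)** with `m = 2` holds.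
[cite: SilvermanAEC2009, Cor. VIII.6.4(b)] -/
theorem exists_abs_naiveHeight_two_nsmul_sub_le_holds :
    exists_abs_naiveHeight_two_nsmul_sub_le (W := W) :=
  exists_abs_naiveHeight_two_nsmul_sub_le_of
    exists_abs_naiveHeight_add_add_naiveHeight_sub_sub_le_holds

/-- **Silverman, AEC Proposition VIII.9.1** (Tate's limit exists) holds.
[cite: SilvermanAEC2009, Prop. VIII.9.1] -/
theorem tendsto_canonicalHeight_holds : tendsto_canonicalHeight (W := W) :=
  tendsto_canonicalHeight_of exists_abs_naiveHeight_two_nsmul_sub_le_holds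

/-- **Silverman, AEC Theorem VIII.9.3(e)** (`ĥ = h + O(1)`) holds.
[cite: SilvermanAEC2009, Thm. VIII.9.3(e)] -/
theorem exists_abs_canonicalHeight_sub_naiveHeight_le_holds :
    exists_abs_canonicalHeight_sub_naiveHeight_le (W := W) :=
  exists_abs_canonicalHeight_sub_naiveHeight_le_of exists_abs_naiveHeight_two_nsmul_sub_le_holds

/-- **Silverman, AEC Theorem VIII.9.3(d)**, first part (`ĥ ≥ 0`) holds.
[cite: SilvermanAEC2009, Thm. VIII.9.3(d)] -/
theorem canonicalHeight_nonneg_holds : canonicalHeight_nonneg (W := W) :=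
  canonicalHeight_nonneg_of tendsto_canonicalHeight_holds

/-- **Silverman, AEC Theorem VIII.9.3(a)** (parallelogram law) holds.
[cite: SilvermanAEC2009, Thm. VIII.9.3(a)] -/
theorem parallelogram_law_holds : parallelogram_law (W := W) :=
  parallelogram_law_of exists_abs_naiveHeight_add_add_naiveHeight_sub_sub_le_holds
    tendsto_canonicalHeight_holds

/-- **Silverman, AEC Theorem VIII.9.3(b)** (`ĥ(nP) = n² ĥ(P)`, `n : ℕ`) holds.
[cite: SilvermanAEC2009, Thm. VIII.9.3(b)] -/
theorem canonicalHeight_nsmul_holds : canonicalHeight_nsmul (W := W) :=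
  canonicalHeight_nsmul_of parallelogram_law_holds

/-- **Silverman, AEC Theorem VIII.9.3(b)** (`ĥ(nP) = n² ĥ(P)`, `n : ℤ`) holds.
[cite: SilvermanAEC2009, Thm. VIII.9.3(b)] -/
theorem canonicalHeight_zsmul_holds : canonicalHeight_zsmul (W := W) :=
  canonicalHeight_zsmul_of canonicalHeight_nsmul_holds

/-- **Silverman, AEC Theorem VIII.9.3(c)** (the Néron–Tate pairing is additive in the first
variable, hence bilinear by symmetry) holds. [cite: SilvermanAEC2009, Thm. VIII.9.3(c)] -/
theorem heightPairing_add_left_holds : heightPairing_add_left (W := W) :=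
  heightPairing_add_left_of parallelogram_law_holds

/-- `⟨P, P⟩ = ĥ(P)` holds (Clay/Wiles normalisation; from VIII.9.3(b) with `n = 2`).
[cite: SilvermanAEC2009, Thm. VIII.9.3(b)] -/
theorem heightPairing_self_holds : heightPairing_self (W := W) :=
  heightPairing_self_of canonicalHeight_nsmul_holds

/-- **Silverman, AEC Theorem VIII.9.3(d)** (`ĥ P = 0 ↔ P` torsion) holds.
[cite: SilvermanAEC2009, Thm. VIII.9.3(d)] -/
theorem canonicalHeight_eq_zero_iff_holds : canonicalHeight_eq_zero_iff (W := W) :=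
  canonicalHeight_eq_zero_iff_of canonicalHeight_nsmul_holds
    exists_abs_canonicalHeight_sub_naiveHeight_le_holds

/-- Northcott for `ĥ` holds (VIII.9.3(e) with VIII.6.1). [cite: SilvermanAEC2009, Prop. VIII.6.1] -/
theorem finite_setOf_canonicalHeight_le_holds : finite_setOf_canonicalHeight_le (W := W) :=
  finite_setOf_canonicalHeight_le_of exists_abs_canonicalHeight_sub_naiveHeight_le_holds
    finite_setOf_naiveHeight_le_holds

end NumberFieldProofs

end WeierstrassCurve.Affine.Point
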